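import Mathlib.NumberTheory.LegendreSymbol.JacobiSymbol
import Mathlib.Tactic.NormNum.LegendreSymbol
import Mathlib.Algebra.Polynomial.Degree.SmallDegree
import Literature.NumberTheory.EllipticCurves.Curve5077aRank
import Literature.NumberTheory.EllipticCurves.BSDRootNumber
import Literature.NumberTheory.DiophantineGeometry.LocalReductionProofs
import Literature.NumberTheory.DiophantineGeometry.LocalReductionHasMultiplicativeReductionAtProofs
import Literature.NumberTheory.DiophantineGeometry.LocalReductionFiniteBadPlacesProofs
import Literature.NumberTheory.DiophantineGeometry.LocalReductionIsIntegralAtProofs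
import Literature.NumberTheory.DiophantineGeometry.LocalReductionIsSemistableAtProofs
import Literature.RingTheory.DiscreteValuationRing.AdicCompletionResidueField
import Literature.NumberTheory.EllipticCurves.Curve5077aAnalyticRank
import Literature.NumberTheory.EllipticCurves.RootNumberAtkinLehnerSemistableProofs
import Literature.NumberTheory.EllipticCurves.SzpiroLocalDataProofs
import Literature.NumberTheory.DiophantineGeometry.PastenValuationProductsProofs
import Literature.Barriers.BirchSwinnertonDyer.NumericalVanishing
import HarnessLib

/-!
# The curve 5077a: the algebraic root number is `−1` (non-split multiplicative reduction at 5077)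

Pure proof file (no named facts, no `sorry`): for the global minimal model
`E : y² + y = x³ − 7x + 6` of the curve `5077a` (Buhler–Gross–Zagier 1985, eq. (2); the tree's
`Literature.NumberTheory.EllipticCurves.Curve5077a.E`) we PROVE

* `localRootNumberAt_E : ∀ v, E.localRootNumberAt v = 1` — every local root number at a finite
  place of `ℤ` is `+1`: at `v ∤ 5077` the discriminant `Δ = 5077` is a `v`-unit, so `E` has good
  reduction (Silverman AEC VII.5, Prop. 5.1(a); Rohrlich 1993, Prop. 2(i)); at the place above
  `5077`, `c₄ = 336` is a unit and `v(Δ) = 1`, so the reduction is multiplicative (AEC VII.5,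
  Prop. 5.1(b)) and it is NON-SPLIT: Mathlib's node-tangent quadratic
  `c₄ T² + a₁c₄ T − (54 b₆ − 3 b₂ b₄ + a₂ c₄) = 336 T² − 1350` has no root in the residue field
  `𝔽₅₀₇₇` because `336 · 1350 = 453600` is a non-residue mod `5077` (Jacobi symbol `−1`); a
  non-split multiplicative place has local root number `+1` (Rohrlich 1993, Prop. 2(ii)).
* `algebraicRootNumber_E : E.algebraicRootNumber = −1` — the algebraic global root number
  `−∏ᶠ_v W_v(E)` is `−1`.

This is the input `halg` of the numerics-free certificate «`3 ≤ ord_{s=1} L(5077a, s)`» of the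
Goldfeld track (the other inputs are the named facts Gross–Zagier–Kolyvagin and
`rootNumber_eq_algebraicRootNumber`): with it, BGZ's printed sign `Λ(s) = −Λ(2 − s)`
(op. cit. (10), p. 478: the Euler factor at `5077` is `(1 + 5077^{−s})^{−1}`, i.e. `a₅₀₇₇ = −1`)
is a theorem about the model, not an input.

Method: the chosen local minimal model `E.localMinimalModel v` differs from `E_{K_v}` (itself
minimal: `c₄` is a unit) by a `K_v`-isomorphism, and split multiplicative reduction is invariant
(`WeierstrassCurve.hasSplitMultiplicativeReduction_iff_of_isMinimal_of_eq_smul`); the integral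
model of `E_{K_v}` has the integer coefficients of `E` (injectivity of `O_v → K_v`); a root of the
node-tangent quadratic in `κ(O_v)` lifts to an integer `r` with `336 r² − 1350 ∈ v = (5077)`
(`IsDedekindDomain.HeightOneSpectrum.residue_comp_algebraMap_surjective`,
`ker_residue_comp_algebraMap`), whence `453600 = (336 r)²` in `ZMod 5077`, contradicting
`ZMod.nonsquare_of_jacobiSym_eq_neg_one`.

## References
* J. P. Buhler, B. H. Gross, D. B. Zagier, Math. Comp. 44 (1985) 473–481, (2) and (10).
  [BuhlerGrossZagier1985]
* J. H. Silverman, *The Arithmetic of Elliptic Curves*, GTM 106, VII.1 Rem. 1.1, VII.5 Prop. 5.1.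
  [SilvermanAEC2009]
* D. Rohrlich, *Variation of the root number in families of twists*, Compositio Math. 87 (1993),
  Prop. 2. [Rohrlich1993Compositio]
-/

open IsDedekindDomain IsDedekindDomain.HeightOneSpectrum WeierstrassCurve Polynomial

namespace Literature.NumberTheory.EllipticCurves.Curve5077a

/-- `c₄(5077a) = 336`. [cite: BuhlerGrossZagier1985, §1 eq. (2)] -/
theorem E_c₄ : E.c₄ = 336 := by
  norm_num [WeierstrassCurve.c₄, WeierstrassCurve.b₂, WeierstrassCurve.b₄, E]

/-- `b₂(5077a) = 0`. [cite: BuhlerGrossZagier1985, §1 eq. (2)] -/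
theorem E_b₂ : E.b₂ = 0 := by norm_num [WeierstrassCurve.b₂, E]

/-- `b₄(5077a) = −14`. [cite: BuhlerGrossZagier1985, §1 eq. (2)] -/
theorem E_b₄ : E.b₄ = -14 := by norm_num [WeierstrassCurve.b₄, E]

/-- `b₆(5077a) = 25`. [cite: BuhlerGrossZagier1985, §1 eq. (2)] -/
theorem E_b₆ : E.b₆ = 25 := by norm_num [WeierstrassCurve.b₆, E]

/-- `E` is integral at every finite place of `ℤ`. [cite: SilvermanAEC2009, VIII.8 (PDF p. 211)] -/
theorem E_isIntegralAt (v : HeightOneSpectrum ℤ) : E.IsIntegralAt v := by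
  rw [isIntegralAt_iff_valuation_le_one]
  refine ⟨?_, ?_, ?_, ?_, ?_⟩
  · simp [E]
  · simp [E]
  · simp [E]
  · have h := v.valuation_le_one (K := ℚ) (-7 : ℤ)
    change v.valuation ℚ ((algebraMap ℤ ℚ) (-7 : ℤ)) ≤ 1 at h
    have e : (algebraMap ℤ ℚ) (-7 : ℤ) = (-7 : ℚ) := by rw [map_neg, map_ofNat]
    rw [e] at h
    simpa [E] using h
  · have h := v.valuation_le_one (K := ℚ) (6 : ℤ)
    change v.valuation ℚ ((algebraMap ℤ ℚ) (6 : ℤ)) ≤ 1 at h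
    have e : (algebraMap ℤ ℚ) (6 : ℤ) = (6 : ℚ) := by rw [map_ofNat]
    rw [e] at h
    simpa [E] using h

/-- At a place `v` with `v(Δ) = 1` (`v ∤ 5077`) the curve has good reduction, so `W_v(E) = 1`.
[cite: Rohrlich1993Compositio, Prop. 2(i)] -/
theorem localRootNumberAt_E_of_valuation_Δ_eq_one (v : HeightOneSpectrum ℤ)
    (h : v.valuation ℚ E.Δ = 1) : E.localRootNumberAt v = 1 :=
  WeierstrassCurve.localRootNumberAt_of_hasGoodReductionAt
    (hasGoodReductionAt_of_valuation_Δ_eq_one_holds v E (E_isIntegralAt v) h)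

/-- If `v(Δ) < 1` then `v` is the place above `5077`: `5077 ∈ v`. [folklore] -/
private theorem mem_of_valuation_Δ_lt_one {v : HeightOneSpectrum ℤ} (h : v.valuation ℚ E.Δ < 1) :
    (5077 : ℤ) ∈ v.asIdeal := by
  rw [E_Δ] at h
  have h' : v.valuation ℚ (algebraMap ℤ ℚ 5077) < 1 := by simpa using h
  exact (v.valuation_lt_one_iff_mem (5077 : ℤ)).mp h'

/-- `336 ∉ v` when `5077 ∈ v` (Bezout: `109·5077 − 1647·336 = 1`). [folklore] -/
private theorem not_mem_336 {v : HeightOneSpectrum ℤ} (h5077 : (5077 : ℤ) ∈ v.asIdeal) :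
    (336 : ℤ) ∉ v.asIdeal := by
  intro h336
  have hone : (1 : ℤ) ∈ v.asIdeal := by
    have := v.asIdeal.add_mem (v.asIdeal.mul_mem_left 109 h5077)
      (v.asIdeal.mul_mem_left (-1647) h336)
    convert this using 1
    norm_num
  exact v.isPrime.ne_top ((Ideal.eq_top_iff_one _).mpr hone)

/-- At the place above `5077`, `c₄ = 336` is a `v`-unit. [cite: SilvermanAEC2009, VII.5 Prop. 5.1(b)] -/
theorem valuation_c₄_eq_one {v : HeightOneSpectrum ℤ} (h5077 : (5077 : ℤ) ∈ v.asIdeal) :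
    v.valuation ℚ E.c₄ = 1 := by
  rw [E_c₄]
  by_contra h
  have h' : v.valuation ℚ (algebraMap ℤ ℚ 336) ≠ 1 := by simpa using h
  have hlt := lt_of_le_of_ne (v.valuation_le_one (336 : ℤ)) h'
  exact not_mem_336 h5077 ((v.valuation_lt_one_iff_mem (336 : ℤ)).mp hlt)

/-- At the place above `5077` the reduction is multiplicative (`v(c₄) = 1`, `v(Δ) < 1`;
Silverman AEC VII.5, Prop. 5.1(b)). [cite: SilvermanAEC2009, VII.5 Prop. 5.1(b) (PDF p. 191)] -/
theorem hasMultiplicativeReductionAt_E {v : HeightOneSpectrum ℤ} (h : v.valuation ℚ E.Δ < 1) :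
    E.HasMultiplicativeReductionAt v :=
  hasMultiplicativeReductionAt_of_valuation_c₄_eq_one (E_isIntegralAt v)
    (valuation_c₄_eq_one (mem_of_valuation_Δ_lt_one h)) h

/-- The arithmetic heart: if `5077 ∈ v` (a proper ideal of `ℤ`) and `336 r² − 1350 ∈ v` for an
integer `r`, then `453600 = (336 r)²` is a square in `ZMod 5077` — impossible, the Jacobi symbol
`(453600 | 5077)` being `−1`. [folklore] -/
private theorem no_int_root {v : HeightOneSpectrum ℤ} (h5077 : (5077 : ℤ) ∈ v.asIdeal) (r : ℤ)
    (hr : 336 * r ^ 2 - 1350 ∈ v.asIdeal) : False := by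
  -- `5077 ∣ 336 r² − 1350`, since otherwise `gcd = 1 ∈ v`
  have hdvd : (5077 : ℤ) ∣ 336 * r ^ 2 - 1350 := by
    by_contra hnd
    have hp : Prime (5077 : ℤ) := Int.prime_iff_natAbs_prime.mpr (by norm_num)
    obtain ⟨a, b, hab⟩ := (hp.coprime_iff_not_dvd).mpr hnd
    have hone : (1 : ℤ) ∈ v.asIdeal := by
      rw [← hab]
      exact v.asIdeal.add_mem (v.asIdeal.mul_mem_left a h5077) (v.asIdeal.mul_mem_left b hr)
    exact v.isPrime.ne_top ((Ideal.eq_top_iff_one _).mpr hone)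
  have hz : ((336 * r ^ 2 - 1350 : ℤ) : ZMod 5077) = 0 :=
    (ZMod.intCast_zmod_eq_zero_iff_dvd _ 5077).mpr (by exact_mod_cast hdvd)
  push_cast at hz
  have hsq : IsSquare ((453600 : ℤ) : ZMod 5077) := by
    refine ⟨((336 * r : ℤ) : ZMod 5077), ?_⟩
    push_cast
    linear_combination (-336 : ZMod 5077) * hz
  exact ZMod.nonsquare_of_jacobiSym_eq_neg_one (a := 453600) (b := 5077) (by norm_num) hsq

/-- **Non-split multiplicative reduction at 5077.** For the place `v` above `5077`, the chosen
local minimal model of `E` does not have split multiplicative reduction: the node-tangent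
quadratic `336 T² − 1350` of the integral model has no root in `κ(O_v) = 𝔽₅₀₇₇`.
(BGZ (10): `a₅₀₇₇ = −1`, Euler factor `(1 + 5077^{-s})^{-1}`.)
[cite: BuhlerGrossZagier1985, §3 eq. (10) (p. 478)] -/
theorem not_hasSplitMultiplicativeReductionAt_E {v : HeightOneSpectrum ℤ}
    (h : v.valuation ℚ E.Δ < 1) : ¬ E.HasSplitMultiplicativeReductionAt v := by
  have h5077 := mem_of_valuation_Δ_lt_one h
  have hc₄ := valuation_c₄_eq_one h5077
  have hW := E_isIntegralAt v
  set O := v.adicCompletionIntegers ℚ with hO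
  set K := v.adicCompletion ℚ with hK
  set EK := E.baseChange K with hEK
  haveI hmin : EK.IsMinimal O :=
    isMinimalAt_of_lt_valuation_c₄ hW
      (by rw [hc₄, ← WithZero.exp_zero]; exact WithZero.exp_lt_exp.mpr (by norm_num))
  haveI : EK.IsElliptic := by rw [hEK, WeierstrassCurve.baseChange]; infer_instance
  obtain ⟨D, hD⟩ : ∃ D : VariableChange K, E.localMinimalModel v = D • EK := ⟨_, rfl⟩
  unfold WeierstrassCurve.HasSplitMultiplicativeReductionAt
  rw [hasSplitMultiplicativeReduction_iff_of_isMinimal_of_eq_smul O hD EK.isUnit_Δ.ne_zero,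
    hasSplitMultiplicativeReduction_iff]
  intro hS
  obtain ⟨hm, hsplit⟩ := hS
  -- the integral model of `EK = E ⊗ K_v` has the integer coefficients of `E`
  have inj := IsFractionRing.injective O K
  have hnat : ∀ n : ℕ, algebraMap O K (n : O) = (n : K) := fun n => map_natCast _ n
  have hc4 : (EK.integralModel O).c₄ = ((336 : ℕ) : O) := inj <| by
    rw [integralModel_c₄_eq, hnat, hEK, WeierstrassCurve.baseChange, map_c₄, E_c₄]; norm_num
  have ha1 : (EK.integralModel O).a₁ = 0 := inj <| by
    rw [integralModel_a₁_eq, hEK, WeierstrassCurve.baseChange, map_a₁]; simp [E]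
  have ha2 : (EK.integralModel O).a₂ = 0 := inj <| by
    rw [integralModel_a₂_eq, hEK, WeierstrassCurve.baseChange, map_a₂]; simp [E]
  have hb2 : (EK.integralModel O).b₂ = 0 := inj <| by
    rw [integralModel_b₂_eq, hEK, WeierstrassCurve.baseChange, map_b₂, E_b₂]; simp
  have hb4 : (EK.integralModel O).b₄ = -((14 : ℕ) : O) := inj <| by
    rw [integralModel_b₄_eq, map_neg, hnat, hEK, WeierstrassCurve.baseChange, map_b₄, E_b₄]; norm_num
  have hb6 : (EK.integralModel O).b₆ = ((25 : ℕ) : O) := inj <| by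
    rw [integralModel_b₆_eq, hnat, hEK, WeierstrassCurve.baseChange, map_b₆, E_b₆]; norm_num
  rw [hc4, ha1, ha2, hb2, hb4, hb6] at hsplit
  push_cast at hsplit
  -- the node-tangent quadratic over `κ(O_v)` is `336 T² − 1350`
  set φ : O →+* IsLocalRing.ResidueField O := algebraMap O (IsLocalRing.ResidueField O) with hφ
  have h336 : (336 : IsLocalRing.ResidueField O) ≠ 0 := by
    intro h0
    have : ((IsLocalRing.residue O).comp (algebraMap ℤ O)) 336 = 0 := by
      rw [RingHom.comp_apply, map_ofNat, map_ofNat]; exact h0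
    have hmem : (336 : ℤ) ∈ v.asIdeal := by
      rw [← ker_residue_comp_algebraMap ℚ v]; exact this
    exact not_mem_336 h5077 hmem
  have hpoly : Polynomial.map φ (C (336 : O) * X ^ 2 + C (0 * 336) * X
      - C (54 * 25 - 3 * 0 * (-14) + 0 * 336)) = C (336 : IsLocalRing.ResidueField O) * X ^ 2
      + C (0 : IsLocalRing.ResidueField O) * X + C (-1350 : IsLocalRing.ResidueField O) := by
    simp only [Polynomial.map_sub, Polynomial.map_add, Polynomial.map_mul, Polynomial.map_pow,
      Polynomial.map_X, map_mul, map_sub, map_add, map_neg, map_ofNat, map_zero]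
    norm_num [sub_eq_add_neg, ← C_neg]
  rw [hpoly] at hsplit
  have hdeg : (C (336 : IsLocalRing.ResidueField O) * X ^ 2 + C (0 : IsLocalRing.ResidueField O) * X
      + C (-1350 : IsLocalRing.ResidueField O)).degree ≠ 0 := by
    rw [degree_quadratic h336]; decide
  obtain ⟨t, ht⟩ := hsplit.exists_eval_eq_zero hdeg
  simp only [eval_add, eval_mul, eval_C, eval_pow, eval_X, zero_mul, add_zero] at ht
  -- lift the root to an integer
  obtain ⟨r, hr⟩ := residue_comp_algebraMap_surjective ℚ v t
  have hι : ((IsLocalRing.residue O).comp (algebraMap ℤ O)) (336 * r ^ 2 - 1350) = 0 := by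
    rw [map_sub, map_mul, map_pow, hr, map_ofNat, map_ofNat]
    linear_combination ht
  have hmem : (336 * r ^ 2 - 1350 : ℤ) ∈ v.asIdeal := by
    rw [← ker_residue_comp_algebraMap ℚ v]; exact hι
  exact no_int_root h5077 r hmem

/-- **Every local root number of `5077a` is `+1`** (good reduction away from `5077`, non-split
multiplicative at `5077`). [cite: Rohrlich1993Compositio, Prop. 2] -/
theorem localRootNumberAt_E (v : HeightOneSpectrum ℤ) : E.localRootNumberAt v = 1 := by
  rcases (WeierstrassCurve.valuation_Δ_le_one_of_isIntegralAt (E_isIntegralAt v)).eq_or_lt with h | h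
  · exact localRootNumberAt_E_of_valuation_Δ_eq_one v h
  · exact localRootNumberAt_of_hasMultiplicativeReductionAt_of_not_split
      (hasMultiplicativeReductionAt_E h) (not_hasSplitMultiplicativeReductionAt_E h)

/-- **The algebraic root number of `5077a` is `−1`**: `−∏ᶠ_v W_v(E) = −1`, all local factors
being `+1` and the archimedean one `−1`. This discharges the hypothesis `halg` of the Goldfeld
track's numerics-free certificate `3 ≤ ord_{s=1} L(5077a, s)`; it matches BGZ's printed sign
`Λ(s) = −Λ(2 − s)`. [cite: BuhlerGrossZagier1985, §3 eq. (10) (p. 478)] -/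
theorem algebraicRootNumber_E : E.algebraicRootNumber = -1 := by
  rw [WeierstrassCurve.algebraicRootNumber, finprod_eq_one_of_forall_eq_one localRootNumberAt_E]

/-- The same statement for the literal equation `⟨0, 0, 1, −7, 6⟩` (so that files using another
name for the model rewrite by `rfl`). [cite: BuhlerGrossZagier1985, §3 eq. (10) (p. 478)] -/
theorem algebraicRootNumber_eq_neg_one :
    (⟨0, 0, 1, -7, 6⟩ : WeierstrassCurve ℚ).algebraicRootNumber = -1 :=
  algebraicRootNumber_E

/-- Hence, under the named fact `rootNumber_eq_algebraicRootNumber` (Deligne–Rohrlich via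
modularity; its additive-place proviso is vacuous for the semistable `5077a`), the analytic root
number of `5077a` is `−1`. [cite: BuhlerGrossZagier1985, §3 eq. (10) (p. 478)] -/
theorem rootNumber_E_of_rootNumber_eq_algebraicRootNumber
    (hRA : E.rootNumber_eq_algebraicRootNumber)
    (hadd : ∀ v : HeightOneSpectrum ℤ, E.HasAdditiveReductionAt v → 3 < ringChar (ℤ ⧸ v.asIdeal)) :
    E.rootNumber = -1 := by
  rw [hRA hadd, algebraicRootNumber_E]


/-! ## Semistability, squarefree conductor, and the analytic root number under modularity -/

/-- **5077a is semistable**: good or multiplicative reduction at every finite place (`v(Δ) = 1`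
away from `5077`; `c₄ = 336` a unit above `5077`). Silverman AEC VII.5, Prop. 5.1.
[cite: SilvermanAEC2009, VII.5 Prop. 5.1 (PDF p. 191)] -/
theorem E_isSemistable : E.IsSemistable ℤ := by
  intro v
  have hint := E_isIntegralAt v
  rcases (WeierstrassCurve.valuation_Δ_le_one_of_isIntegralAt hint).eq_or_lt with h | h
  · exact WeierstrassCurve.isSemistableAt_of_valuation_Δ_eq_one hint h
  · exact WeierstrassCurve.isSemistableAt_of_valuation_c₄_eq_one hint
      (valuation_c₄_eq_one (mem_of_valuation_Δ_lt_one h))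

/-- No place of additive reduction (semistability restated). [cite: SilvermanAEC2009, VII.5 Prop. 5.1 (PDF p. 191)] -/
theorem E_not_hasAdditiveReductionAt (v : HeightOneSpectrum ℤ) : ¬ E.HasAdditiveReductionAt v :=
  (WeierstrassCurve.isSemistableAt_iff_not_hasAdditiveReductionAt v E).mp (E_isSemistable v)

/-- **The conductor of 5077a is squarefree** (semistable ⇔ squarefree conductor, Silverman ATAEC
IV.10.2; tree theorem `isSemistable_iff_squarefree_conductorNorm`). [cite: Silverman1994, IV.10.2] -/
theorem squarefree_conductorNorm_E : Squarefree (E.conductorNorm ℤ) :=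
  E.isSemistable_iff_squarefree_conductorNorm.mp E_isSemistable

/-- **The (analytic) root number of 5077a is `−1`, from modularity alone**: for a curve with
squarefree conductor the tree PROVES `w(E) = −∏_p w_p(E)` from the Modularity Theorem
(`rootNumber_eq_algebraicRootNumber_of_squarefree`, Kellock–Dokchitser 2023 Cor. 2.5 / Atkin–Lehner),
and `−∏_p w_p(E) = −1` by `algebraicRootNumber_E`. This is BGZ's printed sign of the functional
equation, (10): `Λ(s) = −Λ(2 − s)`. [cite: BuhlerGrossZagier1985, §3 eq. (10) (p. 478)] -/
theorem rootNumber_E (hmod : Literature.NumberTheory.EllipticCurves.ModularForms.exists_isNewformOf) :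
    E.rootNumber = -1 :=
  rootNumber_E_of_rootNumber_eq_algebraicRootNumber
    (E.rootNumber_eq_algebraicRootNumber_of_squarefree squarefree_conductorNorm_E hmod)
    (fun v h => (E_not_hasAdditiveReductionAt v h).elim)

/-- **The conductor of 5077a is 5077** (BGZ p. 473: «The conductor of E is 5077»): `N_E = ∏ p^{f_p}`
with `f_v = 1` at the multiplicative place above `5077` and `f_v = 0` at the good places
(Silverman ATAEC IV.10.2 (a),(b); tree theorems `conductorExponent_eq_zero_iff_holds`,
`conductorExponent_eq_one_iff_holds`, `factorization_conductorNorm_primesEquiv_symm`).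
[cite: BuhlerGrossZagier1985, §1 (p. 473)] -/
theorem conductorNorm_E : E.conductorNorm ℤ = 5077 := by
  have h5077 : Nat.Prime 5077 := by norm_num
  refine Nat.eq_of_factorization_eq (E.conductorNorm_pos_holds).ne' (by norm_num) fun p => ?_
  by_cases hp : p.Prime
  swap
  · rw [Nat.factorization_eq_zero_of_not_prime _ hp, Nat.factorization_eq_zero_of_not_prime _ hp]
  rw [show p = ((⟨p, hp⟩ : Nat.Primes) : ℕ) from rfl, factorization_conductorNorm_primesEquiv_symm,
    h5077.factorization]
  set v := (Rat.HeightOneSpectrum.primesEquiv (R := ℤ)).symm ⟨p, hp⟩ with hv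
  have hgen : Rat.HeightOneSpectrum.natGenerator v = p :=
    Literature.NumberTheory.EllipticCurves.Rat.natGenerator_primesEquiv_symm ⟨p, hp⟩
  by_cases hp5 : p = 5077
  · -- the multiplicative place: `f_v = 1`
    have hΔ : v.valuation ℚ E.Δ < 1 := by
      rw [E_Δ, show (5077 : ℚ) = ((5077 : ℤ) : ℚ) by norm_num,
        Literature.NumberTheory.EllipticCurves.Rat.valuation_intCast_lt_one_iff, hgen, hp5]
      norm_num
    rw [(conductorExponent_eq_one_iff_holds v E).mpr (hasMultiplicativeReductionAt_E hΔ)]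
    simp [hp5]
  · -- a good place: `f_v = 0`
    have hΔ : v.valuation ℚ E.Δ = 1 := by
      rw [E_Δ, show (5077 : ℚ) = ((5077 : ℤ) : ℚ) by norm_num,
        Literature.NumberTheory.EllipticCurves.Rat.valuation_intCast_eq_one_iff, hgen]
      intro hd
      exact hp5 ((Nat.prime_dvd_prime_iff_eq hp h5077).mp (by exact_mod_cast hd))
    rw [(conductorExponent_eq_zero_iff_holds v E).mpr
      (hasGoodReductionAt_of_valuation_Δ_eq_one_holds v E (E_isIntegralAt v) hΔ)]
    simp [Ne.symm hp5]

/-- **`3 ≤ ord_{s=1} L(5077a, s)` from exactly two named facts** — the Modularity Theorem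
(`exists_isNewformOf`, giving `w(E) = −1` via `rootNumber_E`) and Gross–Zagier–Kolyvagin in the
form `r_an ≤ 1 ⇒ rank = r_an` (`hGZK`) — through the tree's `Curve5077a.three_le_analyticRank`
(two independent BGZ points + sign `−1`). This is Buhler–Gross–Zagier's «Since L(s) has odd
order, we have ord_{s=1} L(s) ≥ 3» (p. 479) with the exact inputs named and no real-number
computation. [cite: BuhlerGrossZagier1985, §3 (p. 479, after (13))] -/
theorem three_le_analyticRank_E
    (hmod : Literature.NumberTheory.EllipticCurves.ModularForms.exists_isNewformOf)
    (hGZK : rank_eq_analyticRank_of_analyticRank_le_one) : 3 ≤ E.analyticRank :=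
  three_le_analyticRank hGZK (rootNumber_E hmod)

/-- **`ord_{s=1} L(5077a, s) = 3`** from modularity, Gross–Zagier–Kolyvagin and the one remaining
numerical input `h3 : r_an ≤ 3` (`L‴(E,1) ≠ 0`; BGZ (14) print `lim L(s)/(s−1)³ ≈ 1.7318499001193…`,
certified in two lineages of the Goldfeld track to `1.731849900119300689791975085060153 ± 2.4e-34`
but not yet a tree enclosure). [cite: BuhlerGrossZagier1985, §4 eq. (14)] -/
theorem analyticRank_E_eq_three
    (hmod : Literature.NumberTheory.EllipticCurves.ModularForms.exists_isNewformOf)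
    (hGZK : rank_eq_analyticRank_of_analyticRank_le_one) (h3 : E.analyticRank ≤ 3) :
    E.analyticRank = 3 :=
  analyticRank_eq_three hGZK (rootNumber_E hmod) h3

/-- Upper bound from the certified third derivative, in the shape of lead ruling G-4 (C6):
`L‴(E,1) ≠ 0 ⇒ ord_{s=1} L(E,s) ≤ 3`, by contraposing the tree's
`iteratedDeriv_entireLFunction_eq_zero_of_lt_analyticRank`. [cite: BuhlerGrossZagier1985, §4 eq. (14)] -/
theorem analyticRank_E_le_three (h3 : iteratedDeriv 3 E.entireLFunction 1 ≠ 0) :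
    E.analyticRank ≤ 3 := by
  by_contra h
  exact h3 (Literature.Barriers.BirchSwinnertonDyer.iteratedDeriv_entireLFunction_eq_zero_of_lt_analyticRank
    E (by omega))

/-- **`ord_{s=1} L(5077a, s) = 3`** with the numerical hypothesis stated as the certified fact
`L‴(E,1) ≠ 0` (lead ruling G-4; two-lineage enclosure `L‴(E,1)/3! = 1.731849900119300689791975085060153
± 2.4e-34`), from modularity and Gross–Zagier–Kolyvagin. [cite: BuhlerGrossZagier1985, §4 eq. (14)] -/
theorem analyticRank_E_eq_three'
    (hmod : Literature.NumberTheory.EllipticCurves.ModularForms.exists_isNewformOf)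
    (hGZK : rank_eq_analyticRank_of_analyticRank_le_one)
    (h3 : iteratedDeriv 3 E.entireLFunction 1 ≠ 0) : E.analyticRank = 3 :=
  analyticRank_E_eq_three hmod hGZK (analyticRank_E_le_three h3)

end Literature.NumberTheory.EllipticCurves.Curve5077a
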